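import Literature.NumberTheory.EllipticCurves.MazurTateTeitelbaumWeightK
import Literature.NumberTheory.EllipticCurves.TwoVariablePadicLFunctionProofs
import HarnessLib

/-!
# The weight-`k` Mazur–Tate–Teitelbaum interpolation for `ι₀`-rational ordinary members

Topic `Literature/NumberTheory/EllipticCurves`, namespace
`Literature.NumberTheory.EllipticCurves.ModularForms`.

`Literature.NumberTheory.EllipticCurves.MazurTateTeitelbaumWeightK` proves the one-variable
Mazur–Tate–Teitelbaum interpolation in weight `n + 2 ≥ 4` (`exists_mtt_powerSeries_weightK`) for a
newform `g`, a field `K' ⊆ ℂ` with an embedding `ι : K' → ℚ_p`, and a unit root `u ∈ K'`.  The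
hypothesis `hKitagawa` of `core_of_hidaFamily_of_kitagawa`
(`Literature.NumberTheory.EllipticCurves.TwoVariablePadicLFunctionProofs`) speaks instead of a ring
isomorphism `ι₀ : ℚ̄_p ≃ ℂ` (`PadicAlgCl p ≃+* ℂ`) and of members `(k, g, u)` of a `Λ`-adic family
whose `p`-stabilisations `ι₁ g − (a_p(g) − u) ι_p g` have `ι₀`-rational `q`-expansions.  This file
translates: the `ι₀`-rational complex numbers form an intermediate field `ratLocus ι₀` with the
embedding `ratLocusEmb ι₀ : ratLocus ι₀ → ℚ_p` (`algebraMap (ratLocusEmb ι₀ z) = ι₀⁻¹ z`),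
`ι₀`-rationality of the stabilisation propagates to `u` and to all coefficients of `g`
(`mem_ratLocus_of_pStabilisation`), and hence (`exists_mtt_powerSeries_weightK_member`) every such
member has a bounded `L ∈ ℚ_p⟦T⟧` with

  `L(γʲ − 1) = ι₀⁻¹( (1 − pʲ/u)(1 − p^{n−j}/u) · Im(i^{j+1}Λ(g, j+1)) / Ω⁻_g )`   in `ℚ̄_p`

for all `j ≤ n` with `τ ∣ j` — the one-variable fibre, at the arithmetic points `(x_k, γʲ − 1)`, of the
two-variable interpolation asserted by `hKitagawa` (what `hKitagawa` asserts beyond this file is the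
existence of ONE `F ∈ ℤ_p⟦X, Y⟧` patching these `L`'s over the family; Greenberg–Stevens 1993, §5;
Kitagawa 1994, Thm. 1.1).  Everything is proved; there are no named facts.

## References

* B. Mazur, J. Tate, J. Teitelbaum, *On `p`-adic analogues of the conjectures of Birch and
  Swinnerton-Dyer*, Invent. Math. 84 (1986), §I.14 (14.3).
* R. Greenberg, G. Stevens, *`p`-adic `L`-functions and `p`-adic periods of modular forms*,
  Invent. Math. 111 (1993), §5.
* K. Kitagawa, *On standard `p`-adic `L`-functions of families of elliptic cusp forms*, in
  *`p`-adic monodromy and the Birch and Swinnerton-Dyer conjecture*, Contemp. Math. 165 (1994), Thm. 1.1.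
-/

noncomputable section

open scoped MatrixGroups ModularForm Topology
open CongruenceSubgroup Complex MeasureTheory Set Filter
open UpperHalfPlane hiding I

namespace Literature.NumberTheory.EllipticCurves.ModularForms

/-! ### The same through a field isomorphism `ι₀ : ℚ̄_p ≃ ℂ` (the vocabulary of Hida families) -/

section Member

variable {N : ℕ} [NeZero N] {p : ℕ} [Fact p.Prime] {n : ℕ}

/-- **The field of `ι₀`-rational complex numbers**: for a ring isomorphism `ι₀ : ℚ̄_p ≃ ℂ`
(`PadicAlgCl p ≃+* ℂ`), the subfield `{z ∈ ℂ : ι₀⁻¹ z ∈ ℚ_p}` of `ℂ`, as an intermediate field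
over `ℚ`. [folklore] -/
def ratLocus (ι₀ : PadicAlgCl p ≃+* ℂ) : IntermediateField ℚ ℂ :=
  (((algebraMap ℚ_[p] (PadicAlgCl p)).fieldRange.map ι₀.toRingHom)).toIntermediateField fun q ↦
    Subfield.mem_map.mpr ⟨algebraMap ℚ_[p] (PadicAlgCl p) q, ⟨(q : ℚ_[p]), by simp⟩, by simp⟩

/-- Membership in `ratLocus`: `z ∈ ratLocus ι₀ ↔ ι₀⁻¹ z ∈ ℚ_p`. [folklore] -/
theorem mem_ratLocus {ι₀ : PadicAlgCl p ≃+* ℂ} {z : ℂ} :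
    z ∈ ratLocus ι₀ ↔ ι₀.symm z ∈ Set.range (algebraMap ℚ_[p] (PadicAlgCl p)) := by
  change z ∈ ((algebraMap ℚ_[p] (PadicAlgCl p)).fieldRange.map ι₀.toRingHom) ↔ _
  rw [Subfield.mem_map]
  constructor
  · rintro ⟨x, ⟨t, rfl⟩, rfl⟩
    exact ⟨t, by simp⟩
  · rintro ⟨t, ht⟩
    exact ⟨algebraMap ℚ_[p] (PadicAlgCl p) t, ⟨t, rfl⟩, by rw [ht]; simp⟩

/-- **The embedding `ratLocus ι₀ → ℚ_p`**, `z ↦ ι₀⁻¹ z` (read in `ℚ_p`). [folklore] -/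
def ratLocusEmb (ι₀ : PadicAlgCl p ≃+* ℂ) : ratLocus ι₀ →+* ℚ_[p] where
  toFun z := (algebraMap ℚ_[p] (PadicAlgCl p)).rangeRestrictFieldEquiv.symm
    ⟨ι₀.symm z, RingHom.mem_fieldRange.mpr (mem_ratLocus.mp z.2)⟩
  map_one' := by
    apply (algebraMap ℚ_[p] (PadicAlgCl p)).injective
    rw [RingHom.rangeRestrictFieldEquiv_apply_symm_apply]
    simp
  map_mul' z w := by
    apply (algebraMap ℚ_[p] (PadicAlgCl p)).injective
    rw [map_mul, RingHom.rangeRestrictFieldEquiv_apply_symm_apply,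
      RingHom.rangeRestrictFieldEquiv_apply_symm_apply, RingHom.rangeRestrictFieldEquiv_apply_symm_apply]
    simp
  map_zero' := by
    apply (algebraMap ℚ_[p] (PadicAlgCl p)).injective
    rw [RingHom.rangeRestrictFieldEquiv_apply_symm_apply]
    simp
  map_add' z w := by
    apply (algebraMap ℚ_[p] (PadicAlgCl p)).injective
    rw [map_add, RingHom.rangeRestrictFieldEquiv_apply_symm_apply,
      RingHom.rangeRestrictFieldEquiv_apply_symm_apply, RingHom.rangeRestrictFieldEquiv_apply_symm_apply]
    simp

/-- The defining property: `algebraMap ℚ_p ℚ̄_p (ratLocusEmb ι₀ z) = ι₀⁻¹ z`. [folklore] -/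
@[simp] theorem algebraMap_ratLocusEmb (ι₀ : PadicAlgCl p ≃+* ℂ) (z : ratLocus ι₀) :
    algebraMap ℚ_[p] (PadicAlgCl p) (ratLocusEmb ι₀ z) = ι₀.symm z := by
  change algebraMap ℚ_[p] (PadicAlgCl p) ((algebraMap ℚ_[p] (PadicAlgCl p)).rangeRestrictFieldEquiv.symm _) = _
  rw [RingHom.rangeRestrictFieldEquiv_apply_symm_apply]

/-- **`ι₀`-rationality of a `p`-stabilised member propagates to the newform**: if `u` is a root of
`X² − a_p(g) X + p^{n+1}` and every coefficient of the `p`-stabilisation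
`F = ι₁ g − (a_p(g) − u) ι_p g` is `ι₀`-rational (as for the members of a `Λ`-adic family, whose
coefficients are specialisations of series `A_n ∈ ℤ_p⟦X⟧`), then `u` and all the coefficients of `g`
are `ι₀`-rational: `a_p(F) = u`, `a_p(g) − u = p^{n+1}/u`, and
`a_m(g) = a_m(F) + (a_p(g) − u) 𝟙_{p ∣ m} a_{m/p}(g)` (induction on `m`). [folklore] -/
theorem mem_ratLocus_of_pStabilisation (ι₀ : PadicAlgCl p ≃+* ℂ) {g : CuspForm (Gamma0 N) (n + 2)}
    (hg1 : IsNormalized g) {u : ℂ} (hu : u ^ 2 - (qExpansion 1 ⇑g).coeff p * u + (p : ℂ) ^ (n + 1) = 0)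
    (hu0 : u ≠ 0)
    (hmem : ∀ m : ℕ, (qExpansion 1 ⇑(iota N (N * p) 1 (n + 2) (mul_dvd_mul_left N (one_dvd p)) g -
      ((qExpansion 1 ⇑g).coeff p - u) • iota N (N * p) p (n + 2) dvd_rfl g)).coeff m ∈ ratLocus ι₀) :
    u ∈ ratLocus ι₀ ∧ ∀ m : ℕ, (qExpansion 1 ⇑g).coeff m ∈ ratLocus ι₀ := by
  have hp : p.Prime := Fact.out
  have huK : u ∈ ratLocus ι₀ := by
    have h := hmem p
    rwa [qExpansion_coeff_pStabilisation_self g hg1 u] at h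
  have hc : (qExpansion 1 ⇑g).coeff p - u = (p : ℂ) ^ (n + 1) / u := by
    field_simp
    linear_combination -hu
  have hcK : (qExpansion 1 ⇑g).coeff p - u ∈ ratLocus ι₀ := by
    rw [hc]
    exact div_mem (pow_mem (natCast_mem _ p) _) huK
  refine ⟨huK, fun m ↦ ?_⟩
  induction m using Nat.strong_induction_on with
  | _ m ih =>
    have h := hmem m
    rw [qExpansion_coeff_sub_level0, qExpansion_coeff_smul, qExpansion_coeff_iota, qExpansion_coeff_iota,
      if_pos (one_dvd m), Nat.div_one] at h
    by_cases hpm : p ∣ m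
    · rw [if_pos hpm] at h
      rcases Nat.eq_zero_or_pos m with rfl | hm0
      · rw [CuspFormClass.qExpansion_coeff_zero g one_pos (one_mem_strictPeriods_gamma0 N)]
        exact zero_mem _
      · have hlt : m / p < m := Nat.div_lt_self hm0 hp.one_lt
        have e : (qExpansion 1 ⇑g).coeff m = ((qExpansion 1 ⇑g).coeff m -
            ((qExpansion 1 ⇑g).coeff p - u) * (qExpansion 1 ⇑g).coeff (m / p)) +
            ((qExpansion 1 ⇑g).coeff p - u) * (qExpansion 1 ⇑g).coeff (m / p) := by ring
        rw [e]
        exact add_mem h (mul_mem hcK (ih _ hlt))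
    · rw [if_neg hpm, mul_zero, sub_zero] at h
      exact h

/-- **The weight-`k` Mazur–Tate–Teitelbaum interpolation for an `ι₀`-rational ordinary member**
(the vocabulary of `Literature.NumberTheory.EllipticCurves.TwoVariablePadicLFunctionProofs`,
hypothesis `hKitagawa` of `core_of_hidaFamily_of_kitagawa`): for a newform `g ∈ S_{n+2}(Γ₀(N))`
(`n ≥ 2` even, `p ∤ N`), a ring isomorphism `ι₀ : ℚ̄_p ≃ ℂ`, and a root `u` of
`X² − a_p(g)X + p^{n+1}` with `‖ι₀⁻¹u‖ = 1` such that all coefficients of the `p`-stabilisation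
`ι₁ g − (a_p(g) − u) ι_p g` are `ι₀`-rational (`ι₀⁻¹ a_m ∈ ℚ_p`), there is a bounded `L ∈ ℚ_p⟦T⟧`
with `ι₀⁻¹`-valued interpolation
`L(γʲ − 1) = ι₀⁻¹((1 − pʲ/u)(1 − p^{n−j}/u) · Im(i^{j+1}Λ(g, j+1))/Ω⁻_g)` in `ℚ̄_p` for all `j ≤ n`,
`τ ∣ j` (`exists_mtt_powerSeries_weightK` through `ratLocus ι₀`, `ratLocusEmb ι₀`,
`mem_ratLocus_of_pStabilisation`). [cite: MazurTateTeitelbaum1986Invent, §I.14 (14.3)] -/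
theorem exists_mtt_powerSeries_weightK_member (hpN : ¬ p ∣ N) (hn : Even n) (hn0 : n ≠ 0)
    {g : CuspForm (Gamma0 N) (n + 2)} (hg : IsNewform0 g) (ι₀ : PadicAlgCl p ≃+* ℂ) {u : ℂ}
    (hu : u ^ 2 - (qExpansion 1 ⇑g).coeff p * u + (p : ℂ) ^ (n + 1) = 0) (hunit : ‖ι₀.symm u‖ = 1)
    (hmem : ∀ m : ℕ, ι₀.symm ((qExpansion 1 ⇑(iota N (N * p) 1 (n + 2) (mul_dvd_mul_left N (one_dvd p)) g -
      ((qExpansion 1 ⇑g).coeff p - u) • iota N (N * p) p (n + 2) dvd_rfl g)).coeff m) ∈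
        Set.range (algebraMap ℚ_[p] (PadicAlgCl p))) :
    ∃ (L : PowerSeries ℚ_[p]) (C : ℝ) (Ω : ℝ), Ω ≠ 0 ∧
      (∀ k, ‖PowerSeries.coeff k L‖ ≤ C) ∧
      (∀ z ∈ Submodule.span (coeffField g)
        ((fun φ : Module.Dual ℂ (CuspForm (Gamma0 N) (n + 2)) ↦ φ g) '' (cuspidalLatticeK (N := N) n)),
        ∃ q : ℂ, q ∈ coeffField g ∧ ((z.im : ℝ) : ℂ) = q * Ω) ∧
      ∀ j : ℕ, j ≤ n → torsionOrder p ∣ j →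
        algebraMap ℚ_[p] (PadicAlgCl p) (padicEval L (((cyclotomicGenerator p : ℕ) : ℚ_[p]) ^ j - 1)) =
          ι₀.symm ((1 - (p : ℂ) ^ j / u) * (1 - (p : ℂ) ^ (n - j) / u) *
            ((((I ^ (j + 1) * completedLValue g (j + 1)).im / Ω : ℝ)) : ℂ)) ∧
          ((((I ^ (j + 1) * completedLValue g (j + 1)).im : ℝ)) : ℂ) * I =
            I ^ (j + 1) * completedLValue g (j + 1) := by
  have hu0 : u ≠ 0 := fun h ↦ by
    rw [h, map_zero, norm_zero] at hunit
    exact zero_ne_one hunit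
  obtain ⟨huK, hcoeff⟩ := mem_ratLocus_of_pStabilisation ι₀ hg.2.2 hu hu0 (fun m ↦ mem_ratLocus.mpr (hmem m))
  have hK : coeffField g ≤ ratLocus ι₀ := by
    change IntermediateField.adjoin ℚ _ ≤ _
    rw [IntermediateField.adjoin_le_iff]
    rintro _ ⟨m, rfl⟩
    exact hcoeff m
  have hunit' : ‖ratLocusEmb ι₀ ⟨u, huK⟩‖ = 1 := by
    rw [← norm_algebraMap' (PadicAlgCl p), algebraMap_ratLocusEmb]
    exact hunit
  obtain ⟨L, C, Ω, hΩ, hLC, hper, hL⟩ :=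
    exists_mtt_powerSeries_weightK hpN hn hn0 hg (ratLocus ι₀) (ratLocusEmb ι₀) hK huK hu hunit'
  refine ⟨L, C, Ω, hΩ, hLC, hper, fun j hj hτ ↦ ?_⟩
  obtain ⟨hm, hval, hre⟩ := hL j hj hτ
  refine ⟨?_, hre⟩
  rw [hval, algebraMap_ratLocusEmb]

/-- **The same in the binders of `hKitagawa`** (`Literature.NumberTheory.EllipticCurves.TwoVariablePadicLFunctionProofs`,
`core_of_hidaFamily_of_kitagawa`): weight `k : ℤ` with `2 < k`, `(p − 1) ∣ (k − 2)` (`p ≥ 3`), the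
root equation with `p^{k−1}`, and the critical points `0 < n < k` with `(p − 1) ∣ (n − 1)`, at which
`L((1 + p)^{n−1} − 1) = ι₀⁻¹((1 − p^{n−1}/u)(1 − p^{k−1−n}/u) · Im(iⁿ Λ(g, n))/Ω⁻_g)` (`γ = 1 + p`,
`τ = p − 1` for odd `p`). [cite: MazurTateTeitelbaum1986Invent, §I.14 (14.3)] -/
theorem exists_mtt_powerSeries_weightK_member' (hp3 : 3 ≤ p) (hpN : ¬ p ∣ N) {k : ℤ} (hk : 2 < k)
    (hpk : ((p : ℤ) - 1) ∣ (k - 2)) {g : CuspForm (Gamma0 N) k} (hg : IsNewform0 g)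
    (ι₀ : PadicAlgCl p ≃+* ℂ) {u : ℂ}
    (hu : u ^ 2 - (qExpansion 1 ⇑g).coeff p * u + (p : ℂ) ^ (k - 1) = 0) (hunit : ‖ι₀.symm u‖ = 1)
    (hmem : ∀ m : ℕ, ι₀.symm ((qExpansion 1 ⇑(iota N (N * p) 1 k (mul_dvd_mul_left N (one_dvd p)) g -
      ((qExpansion 1 ⇑g).coeff p - u) • iota N (N * p) p k dvd_rfl g)).coeff m) ∈
        Set.range (algebraMap ℚ_[p] (PadicAlgCl p))) :
    ∃ (L : PowerSeries ℚ_[p]) (C : ℝ) (Ω : ℝ), Ω ≠ 0 ∧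
      (∀ i, ‖PowerSeries.coeff i L‖ ≤ C) ∧
      ∀ n : ℕ, 0 < n → (n : ℤ) < k → (p - 1) ∣ (n - 1) →
        algebraMap ℚ_[p] (PadicAlgCl p) (padicEval L ((1 + (p : ℚ_[p])) ^ (n - 1) - 1)) =
          ι₀.symm ((1 - (p : ℂ) ^ (n - 1) / u) * (1 - (p : ℂ) ^ (k - 1 - n) / u) *
            ((((I ^ n * completedLValue g n).im / Ω : ℝ)) : ℂ)) ∧
          ((((I ^ n * completedLValue g n).im : ℝ)) : ℂ) * I = I ^ n * completedLValue g n := by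
  have hp : p.Prime := Fact.out
  have hp2 : p ≠ 2 := by omega
  -- the weight `k = m + 2`, `m` even and non-zero
  obtain ⟨m, rfl⟩ : ∃ m : ℕ, k = (m : ℤ) + 2 := ⟨(k - 2).toNat, by omega⟩
  have hm0 : m ≠ 0 := by rintro rfl; simp at hk
  have hmeven : Even m := by
    have h1 : ((p - 1 : ℕ) : ℤ) ∣ (m : ℤ) := by
      rw [Nat.cast_sub hp.one_le, Nat.cast_one]; simpa using hpk
    have h2 : (p - 1 : ℕ) ∣ m := by exact_mod_cast h1
    obtain ⟨c, hc⟩ := h2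
    rw [hc]
    exact (hp.even_sub_one hp2).mul_right c
  have hu' : u ^ 2 - (qExpansion 1 ⇑g).coeff p * u + (p : ℂ) ^ (m + 1) = 0 := by
    have e : (p : ℂ) ^ ((m : ℤ) + 2 - 1) = (p : ℂ) ^ (m + 1) := by
      rw [show ((m : ℤ) + 2 - 1) = ((m + 1 : ℕ) : ℤ) by push_cast; ring, zpow_natCast]
    rwa [e] at hu
  obtain ⟨L, C, Ω, hΩ, hLC, -, hL⟩ := exists_mtt_powerSeries_weightK_member hpN hmeven hm0 hg ι₀ hu' hunit hmem
  refine ⟨L, C, Ω, hΩ, hLC, fun n hn0 hnk hpn ↦ ?_⟩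
  have hj : n - 1 ≤ m := by omega
  have hτ : torsionOrder p ∣ (n - 1) := by rw [torsionOrder_eq, if_neg hp2]; exact hpn
  obtain ⟨hval, hre⟩ := hL (n - 1) hj hτ
  have hγ : ((cyclotomicGenerator p : ℕ) : ℚ_[p]) = 1 + p := by
    have he : cyclotomicExponent p = 1 := if_neg hp2
    rw [cyclotomicGenerator, he, pow_one]; push_cast; ring
  have hn1 : n - 1 + 1 = n := Nat.sub_add_cancel hn0
  rw [hn1] at hval hre
  rw [hγ] at hval
  refine ⟨?_, hre⟩
  rw [show ((m : ℤ) + 2 - 1 - (n : ℤ)) = ((m - (n - 1) : ℕ) : ℤ) by omega, zpow_natCast]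
  exact hval

end Member

end Literature.NumberTheory.EllipticCurves.ModularForms
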